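/-
Copyright: the b2b-balaban T⁴-continuum CRUX team, row NE7b leaf lineage `t4-ne7b-formalise-leaf-06` (gen 156). Project licence.
-/
import Mathlib.Analysis.Calculus.FDeriv.Add
import Mathlib.Analysis.Normed.Operator.BoundedLinearMaps
import Mathlib.Tactic.Positivity
import Mathlib.Tactic.FieldSimp
import Mathlib.Tactic.Linarith

/-!
# THE HARD STEP IN COERCIVITY UNITS: scaling an action by a positive constant `θ` scales every letter of the inductive step
# (`V″ ↦ θV″`, `m ↦ θm`, `c ↦ θc`, `M₃, B, G ↦ θM₃, θB, θG`) and leaves critical points, charts and the slice alone; at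
# `θ = m⁻¹` (the action measured in units of its own kernel coercivity) the equivalence letter `(1 + ‖V″δ₀‖∕m)‖M‖ + m⁻¹ ≤ N`
# becomes the DIMENSIONLESS `(1 + ‖V″δ₀‖∕m)‖M‖ + 1 ≤ N`, and the closing quantities of the step-plus-rescaling are `t`-FREE
# (row NE7b, node U5c; Mathlib only; [folklore] calculus and real arithmetic — the pricing desk's units remark F634 made a lemma)

Cell `pub-balaban`, sub-cell `t4`, spine estimate NE7b (`T4WeightBudget.RelWeightBound`; the cell's OWN estimate — NOT PRINTED in
[Bałaban 1983–89], NOT PROVED).  Crux-route work under `Spine/NE7b/` by a row leaf (`t4-ne7b-formalise-leaf-06` gen 156) in the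
hard-step cell under FREEZE (0)'s crux-prover clause; NOTHING of Bałaban's is named as a Lean object, valued or asserted; no
`T4Continuum/Support` leaf typed; no `def`; zero `sorry`.  Imports: Mathlib only (fast lane).  Consumers: this lineage's
`…HardStepInductiveStep` (HSIS, `inductiveStep`: its hypothesis block is produced here letter by letter for the normalised action
`m⁻¹ • V` with kernel coercivity `1`), `…HardStepTowerTwoSteps` (HSTT) and `…HardStepTowerBox` (HSTB: its `hN` letter
`(1 + s²B∕m)μ + m⁻¹ ≤ N` is the un-normalised form whose last summand carries inverse-Hessian units).

WHY (located).  PRICING-NE7b F634 on HSTT: «in `hN₂` the ratio `BK₁²d²∕m₂` is `t`-free while `(t²m₂∕d²)⁻¹` is not, because AHE's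
`N = (1 + ‖Q‖∕m)‖M‖ + m⁻¹` mixes a dimensionless with a dimensional summand — WHICH normalisation `t` print uses decides `N₂`'s
size, a units question the value audit must fix once»; idea-1's T-101 (N-101-4): print keeps its letters dimensionless by weighted
norms ([B11] (2), (8)–(10), (46), (117): both inverse bounds are dimensionless constants `B₀`).  In the abstract hard step the
weight is ONE number: measure the action in units of its kernel coercivity.  `θ • V` has the same critical points, the same
constrained critical branch and the same slice as `V`; its Hessian, coercivity, modulus and sizes are `θ` times those of `V`; so at
`θ = m⁻¹` the augmented Hessian `h ↦ (Dh, m⁻¹V″(δ₀)h|_K)` has the inverse bound `(1 + ‖V″δ₀‖∕m)‖M‖ + 1` (AHE's formula at coercivity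
`1`) and the Neumann margin reads `c∕m < N⁻¹` — every letter dimensionless, as in print.  §3 then records, as identities of real
numbers, that after «step → homothety `t` → re-normalisation by the next coercivity `t²γ∕d²`» (TFC's two-scale letter `γ = m₂∕m`,
blocking size `d`) the four closing quantities of HSTB — next Hessian size, next modulus requirement at the radius
`r₂ = λ·K₁⁻¹r∕|t|`, next gradient size over the next radius, next equivalence condition — contain NO `t` at all: the homothety is a
change of units (F627 ∕ F644 «no margin»), the margin is `γ∕d²` and the chart constant `K₁`.

WHAT IS PROVED ([folklore]; `E`, `F` real normed spaces, `V : E → ℝ`, `θ : ℝ`; `θ • V` is the pointwise multiple):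
* §1 SCALING AN ACTION: `hasFDerivAt_fderiv_smul` (`HasFDerivAt (fderiv V) (V″x) x ⟹ HasFDerivAt (fderiv (θ•V)) (θ•V″x) x`, any `θ` —
  via Mathlib's unconditional `fderiv_const_smul_field`), `norm_fderiv_smul` (`‖D(θ•V)(x)‖ = |θ|‖DV(x)‖`), `fderiv_smul_eq_zero`
  (criticality is kept), `kerCoercive_smul` (`m‖κ‖² ≤ Qκκ` on `ker D` ⟹ `θm‖κ‖² ≤ (θ•Q)κκ`, `θ ≥ 0`), `norm_smul_sub_smul_le`
  (moduli and Lipschitz letters scale by `θ ≥ 0`), `norm_smul_le_of_le`.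
* §2 COERCIVITY UNITS (`θ = m⁻¹`, `m > 0`): `unit_kerCoercive` (coercivity `1`), `unit_equivBound`
  (`(1 + ‖V″δ₀‖∕m)‖M‖ + 1 ≤ N ⟹ (1 + ‖m⁻¹•V″δ₀‖∕1)‖M‖ + 1⁻¹ ≤ N` — AHE's ∕ HSIS's `hN` at coercivity `1`), `unit_modulus`
  (`‖V″x − V″δ₀‖ ≤ c·m ⟹ ‖m⁻¹•V″x − m⁻¹•V″δ₀‖ ≤ c`), `unit_lipschitz`, `unit_size`, `unit_gradient` — HSIS `inductiveStep`'s hypotheses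
  `hco`, `hN`, `hVc`, `hV''lip`, `hVB`, `hVG` for `m⁻¹ • V` with `(m, c, M₃, B, G) := (1, c, M₃∕m, B∕m, G∕m)`, letter by letter.
* §3 THE CLOSING QUANTITIES ARE `t`-FREE IN COERCIVITY UNITS (real identities, `t ≠ 0`; `K₁, γ, d, λ, r` arbitrary reals, `K₁ ≠ 0` where
  divided): `nextHessianSize_unit` (`t²(x_B K₁²) ∕ (t²γ∕d²) = x_B K₁² d²∕γ`), `nextModulusNeed_unit`
  (`|t|³Λ · (λK₁⁻¹r∕|t|) ∕ (t²γ∕d²) = λΛK₁⁻¹r·d²∕γ`), `nextGradientOverRadius_unit` (`(|t|x_G K₁ ∕ (t²γ∕d²)) ∕ (λK₁⁻¹r∕|t|) = x_G K₁² d²∕(γλr)`),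
  `nextEquivCondition_unit`; the END `closing_letters_t_free` (the conjunction).
* §4 toys.

NOT HERE (honest): the values of `γ = m₂∕m`, `d`, `K₁`, `λ` for print's small-field action and blockings ((A3) ∕ (A1c), NC-NE7b-α
UNRULED; leaf-01's `TwoScalePoincareBlocking` values `γ, d` for the free lattice field); the normalised inductive step itself
(`inductiveStep` applied to `m⁻¹ • V` — one `exact` away, in a file importing HSIS once its olean exists); anything of Bałaban's.
BY-NAME EFFECT ON THE WALL: NONE.  NE7b NOT PRINTED ∕ NOT PROVED; spine PROVED 0∕9; rung (B)+1 on a FINITE torus — NOT infinite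
volume, NOT the mass gap, NOT Clay.  HONEST DEPENDENCY: continuum YM on T⁴ ⇐ BetaPertH ∧ nine spine estimates (0∕9 proved);
BetaPertH ⇐ (D1) ∧ (D4) ∧ CAP+tail; G-an2-4 gates asym, D1 and NE2∕3∕4.
-/

set_option autoImplicit false

namespace Summit.QuantumFields.BalabanUV.T4Continuum.NE7b.ActionScalingLetters

open Metric Set

/-! ## §1. Scaling an action by a constant -/

section Scaling

variable {E F : Type*} [NormedAddCommGroup E] [NormedSpace ℝ E] [NormedAddCommGroup F] [NormedSpace ℝ F]

/-- **THE HESSIAN SCALES**: `HasFDerivAt (fderiv V) (V″x) x ⟹ HasFDerivAt (fderiv (θ • V)) (θ • V″x) x`, for ANY `θ` (no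
differentiability hypothesis on `V` elsewhere: `fderiv (θ • V) = θ • fderiv V` identically). [folklore] -/
theorem hasFDerivAt_fderiv_smul {V : E → ℝ} {V'' : E →L[ℝ] E →L[ℝ] ℝ} {x : E} (θ : ℝ)
    (h : HasFDerivAt (fderiv ℝ V) V'' x) : HasFDerivAt (fderiv ℝ (θ • V)) (θ • V'') x := by
  rw [fderiv_const_smul_field]
  exact h.const_smul θ

/-- The gradient scales: `‖D(θ • V)(x)‖ = |θ|·‖DV(x)‖`. [folklore] -/
theorem norm_fderiv_smul (V : E → ℝ) (θ : ℝ) (x : E) : ‖fderiv ℝ (θ • V) x‖ = |θ| * ‖fderiv ℝ V x‖ := by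
  rw [fderiv_const_smul_field, Pi.smul_apply, norm_smul, Real.norm_eq_abs]

/-- **CRITICAL POINTS ARE KEPT**: `DV(δ₀) = 0 ⟹ D(θ • V)(δ₀) = 0`. [folklore] -/
theorem fderiv_smul_eq_zero {V : E → ℝ} {δ₀ : E} (θ : ℝ) (h : fderiv ℝ V δ₀ = 0) : fderiv ℝ (θ • V) δ₀ = 0 := by
  rw [fderiv_const_smul_field, Pi.smul_apply, h, smul_zero]

/-- Differentiability is kept. [folklore] -/
theorem differentiableAt_smul {V : E → ℝ} {x : E} (θ : ℝ) (h : DifferentiableAt ℝ V x) :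
    DifferentiableAt ℝ (θ • V) x := h.const_smul θ

/-- **KERNEL COERCIVITY SCALES**: `m‖κ‖² ≤ Q κ κ` on `ker D` ⟹ `(θm)‖κ‖² ≤ (θ • Q) κ κ` on `ker D`, `θ ≥ 0`. [folklore] -/
theorem kerCoercive_smul (D : E →L[ℝ] F) {Q : E →L[ℝ] E →L[ℝ] ℝ} {m θ : ℝ} (hθ : 0 ≤ θ)
    (hco : ∀ κ, D κ = 0 → m * ‖κ‖ ^ 2 ≤ Q κ κ) : ∀ κ, D κ = 0 → θ * m * ‖κ‖ ^ 2 ≤ (θ • Q) κ κ := by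
  intro κ hκ
  change θ * m * ‖κ‖ ^ 2 ≤ θ * Q κ κ
  rw [mul_assoc]
  exact mul_le_mul_of_nonneg_left (hco κ hκ) hθ

/-- Moduli and Lipschitz letters scale: `‖A − B‖ ≤ C ⟹ ‖θ•A − θ•B‖ ≤ θC` (`θ ≥ 0`). [folklore] -/
theorem norm_smul_sub_smul_le {G : Type*} [NormedAddCommGroup G] [NormedSpace ℝ G] {A B : G} {C θ : ℝ} (hθ : 0 ≤ θ)
    (h : ‖A - B‖ ≤ C) : ‖θ • A - θ • B‖ ≤ θ * C := by
  rw [← smul_sub, norm_smul, Real.norm_eq_abs, abs_of_nonneg hθ]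
  exact mul_le_mul_of_nonneg_left h hθ

/-- Sizes scale: `‖A‖ ≤ C ⟹ ‖θ•A‖ ≤ θC` (`θ ≥ 0`). [folklore] -/
theorem norm_smul_le_of_le {G : Type*} [NormedAddCommGroup G] [NormedSpace ℝ G] {A : G} {C θ : ℝ} (hθ : 0 ≤ θ)
    (h : ‖A‖ ≤ C) : ‖θ • A‖ ≤ θ * C := by
  rw [norm_smul, Real.norm_eq_abs, abs_of_nonneg hθ]
  exact mul_le_mul_of_nonneg_left h hθ

end Scaling

/-! ## §2. Coercivity units: the letters of `m⁻¹ • V` in `inductiveStep`'s shapes -/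

section Unit

variable {E F : Type*} [NormedAddCommGroup E] [NormedSpace ℝ E] [NormedAddCommGroup F] [NormedSpace ℝ F]

/-- **COERCIVITY ONE**: `m‖κ‖² ≤ V″(δ₀) κ κ` on `ker D`, `m > 0` ⟹ `1·‖κ‖² ≤ (m⁻¹ • V″(δ₀)) κ κ` on `ker D` (HSIS's `hco` at `m := 1`).
[folklore] -/
theorem unit_kerCoercive (D : E →L[ℝ] F) {Q : E →L[ℝ] E →L[ℝ] ℝ} {m : ℝ} (hm : 0 < m)
    (hco : ∀ κ, D κ = 0 → m * ‖κ‖ ^ 2 ≤ Q κ κ) : ∀ κ, D κ = 0 → 1 * ‖κ‖ ^ 2 ≤ (m⁻¹ • Q) κ κ := by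
  have h := kerCoercive_smul D (inv_pos.mpr hm).le hco
  simpa only [inv_mul_cancel₀ hm.ne'] using h

/-- **THE DIMENSIONLESS EQUIVALENCE LETTER**: `(1 + ‖V″δ₀‖∕m)‖M‖ + 1 ≤ N`, `m > 0` ⟹ HSIS's `hN` for `m⁻¹ • V″` at coercivity `1`:
`(1 + ‖m⁻¹ • V″δ₀‖∕1)‖M‖ + 1⁻¹ ≤ N` (AHE's inverse bound of the augmented Hessian `h ↦ (Dh, m⁻¹V″(δ₀)h|_K)`). [folklore] -/
theorem unit_equivBound {G : Type*} [NormedAddCommGroup G] [NormedSpace ℝ G] {Q : G} {m nM N : ℝ} (hm : 0 < m)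
    (h : (1 + ‖Q‖ / m) * nM + 1 ≤ N) : (1 + ‖m⁻¹ • Q‖ / 1) * nM + (1 : ℝ)⁻¹ ≤ N := by
  rw [div_one, inv_one, norm_smul, Real.norm_eq_abs, abs_of_pos (inv_pos.mpr hm), inv_mul_eq_div]
  exact h

/-- **THE DIMENSIONLESS MODULUS**: `‖V″x − V″δ₀‖ ≤ c·m`, `m > 0` ⟹ `‖m⁻¹•V″x − m⁻¹•V″δ₀‖ ≤ c` (HSIS's `hVc`). [folklore] -/
theorem unit_modulus {G : Type*} [NormedAddCommGroup G] [NormedSpace ℝ G] {A B : G} {c m : ℝ} (hm : 0 < m)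
    (h : ‖A - B‖ ≤ c * m) : ‖m⁻¹ • A - m⁻¹ • B‖ ≤ c := by
  have h1 := norm_smul_sub_smul_le (inv_pos.mpr hm).le h
  rwa [mul_comm c m, ← mul_assoc, inv_mul_cancel₀ hm.ne', one_mul] at h1

/-- The Hessian-Lipschitz letter in coercivity units: `‖V″x − V″x′‖ ≤ M₃‖x − x′‖ ⟹ ‖m⁻¹•V″x − m⁻¹•V″x′‖ ≤ (M₃∕m)‖x − x′‖`
(HSIS's `hV''lip`). [folklore] -/
theorem unit_lipschitz {G : Type*} [NormedAddCommGroup G] [NormedSpace ℝ G] {A B : G} {M₃ m δ : ℝ} (hm : 0 < m)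
    (h : ‖A - B‖ ≤ M₃ * δ) : ‖m⁻¹ • A - m⁻¹ • B‖ ≤ M₃ / m * δ := by
  have h1 := norm_smul_sub_smul_le (inv_pos.mpr hm).le h
  rwa [← mul_assoc, inv_mul_eq_div] at h1

/-- The Hessian size in coercivity units: `‖V″x‖ ≤ B ⟹ ‖m⁻¹•V″x‖ ≤ B∕m` (HSIS's `hVB`). [folklore] -/
theorem unit_size {G : Type*} [NormedAddCommGroup G] [NormedSpace ℝ G] {A : G} {B m : ℝ} (hm : 0 < m) (h : ‖A‖ ≤ B) :
    ‖m⁻¹ • A‖ ≤ B / m := by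
  have h1 := norm_smul_le_of_le (inv_pos.mpr hm).le h
  rwa [inv_mul_eq_div] at h1

/-- The gradient size in coercivity units: `‖DV(x)‖ ≤ G ⟹ ‖D(m⁻¹•V)(x)‖ ≤ G∕m` (HSIS's `hVG`). [folklore] -/
theorem unit_gradient {V : E → ℝ} {x : E} {G m : ℝ} (hm : 0 < m) (h : ‖fderiv ℝ V x‖ ≤ G) :
    ‖fderiv ℝ (m⁻¹ • V) x‖ ≤ G / m := by
  rw [norm_fderiv_smul, abs_of_pos (inv_pos.mpr hm), inv_mul_eq_div]
  exact div_le_div_of_nonneg_right h hm.le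

/-- **ALL OF `inductiveStep`'s ACTION LETTERS IN COERCIVITY UNITS AT ONCE.**  From the scale-`k` letters of `V` on `closedBall δ₀ r`
(kernel coercivity `m > 0` of `V″(δ₀)` on `ker D`, `HasFDerivAt (fderiv V) (V″x) x`, the modulus `‖V″x − V″δ₀‖ ≤ c·m`, the
Lipschitz letter `M₃`, the sizes `B`, `G`, differentiability, FULL criticality) — the same letters for `m⁻¹ • V` with Hessian
`m⁻¹ • V″`, coercivity `1`, modulus `c`, Lipschitz `M₃∕m`, sizes `B∕m`, `G∕m`. [folklore] -/
theorem unit_letters (D : E →L[ℝ] F) {V : E → ℝ} {V'' : E → E →L[ℝ] E →L[ℝ] ℝ} {δ₀ : E} {m : ℝ} (hm : 0 < m)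
    (hco : ∀ κ, D κ = 0 → m * ‖κ‖ ^ 2 ≤ V'' δ₀ κ κ) {r c M₃ B G : ℝ}
    (hVd : ∀ x ∈ closedBall δ₀ r, DifferentiableAt ℝ V x)
    (hV : ∀ x ∈ closedBall δ₀ r, HasFDerivAt (fderiv ℝ V) (V'' x) x)
    (hVc : ∀ x ∈ closedBall δ₀ r, ‖V'' x - V'' δ₀‖ ≤ c * m)
    (hcrit0 : fderiv ℝ V δ₀ = 0)
    (hV''lip : ∀ x ∈ closedBall δ₀ r, ∀ x' ∈ closedBall δ₀ r, ‖V'' x - V'' x'‖ ≤ M₃ * ‖x - x'‖)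
    (hVB : ∀ x ∈ closedBall δ₀ r, ‖V'' x‖ ≤ B) (hVG : ∀ x ∈ closedBall δ₀ r, ‖fderiv ℝ V x‖ ≤ G) :
    (∀ κ, D κ = 0 → 1 * ‖κ‖ ^ 2 ≤ (m⁻¹ • V'' δ₀) κ κ) ∧
      (∀ x ∈ closedBall δ₀ r, DifferentiableAt ℝ (m⁻¹ • V) x) ∧
      (∀ x ∈ closedBall δ₀ r, HasFDerivAt (fderiv ℝ (m⁻¹ • V)) (m⁻¹ • V'' x) x) ∧
      (∀ x ∈ closedBall δ₀ r, ‖m⁻¹ • V'' x - m⁻¹ • V'' δ₀‖ ≤ c) ∧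
      fderiv ℝ (m⁻¹ • V) δ₀ = 0 ∧
      (∀ x ∈ closedBall δ₀ r, ∀ x' ∈ closedBall δ₀ r, ‖m⁻¹ • V'' x - m⁻¹ • V'' x'‖ ≤ M₃ / m * ‖x - x'‖) ∧
      (∀ x ∈ closedBall δ₀ r, ‖m⁻¹ • V'' x‖ ≤ B / m) ∧
      (∀ x ∈ closedBall δ₀ r, ‖fderiv ℝ (m⁻¹ • V) x‖ ≤ G / m) := by
  refine ⟨unit_kerCoercive D hm hco, ?_, ?_, ?_, fderiv_smul_eq_zero _ hcrit0, ?_, ?_, ?_⟩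
  · intro x hx; exact differentiableAt_smul _ (hVd x hx)
  · intro x hx; exact hasFDerivAt_fderiv_smul _ (hV x hx)
  · intro x hx; refine unit_modulus (G := E →L[ℝ] E →L[ℝ] ℝ) hm ?_; exact hVc x hx
  · intro x hx x' hx'; refine unit_lipschitz (G := E →L[ℝ] E →L[ℝ] ℝ) hm ?_; exact hV''lip x hx x' hx'
  · intro x hx; refine unit_size (G := E →L[ℝ] E →L[ℝ] ℝ) hm ?_; exact hVB x hx
  · intro x hx; exact unit_gradient hm (hVG x hx)

end Unit

/-! ## §3. The closing quantities are `t`-free in coercivity units -/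

section TFree

/-- **NEXT HESSIAN SIZE**: after the step (`x_B ↦ x_B K₁²`), the homothety (`· t²`) and re-normalisation by the next coercivity
`t²γ∕d²` (TFC: `γ` the two-scale coercivity in units of `m`, `d` the blocking's size): `t²(x_B K₁²) ∕ (t²(γ∕d²)) = x_B K₁² d²∕γ` —
NO `t` (F634's `BK₁²d²∕m₂`). [folklore] -/
theorem nextHessianSize_unit {t : ℝ} (ht : t ≠ 0) (xB K₁ γ d : ℝ) :
    t ^ 2 * (xB * K₁ ^ 2) / (t ^ 2 * (γ / d ^ 2)) = xB * K₁ ^ 2 * d ^ 2 / γ := by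
  have ht2 : t ^ 2 ≠ 0 := pow_ne_zero 2 ht
  rw [mul_div_mul_left _ _ ht2, div_div_eq_mul_div]

/-- **NEXT MODULUS REQUIREMENT**: the next Hessian-Lipschitz constant `|t|³Λ` times the next radius `r₂ = λ·K₁⁻¹r∕|t|` (a fraction
`λ` of the chart's radius `K₁⁻¹r∕|t|`), re-normalised by `t²γ∕d²`: `= λ·Λ·K₁⁻¹r·d²∕γ` — NO `t`. [folklore] -/
theorem nextModulusNeed_unit {t : ℝ} (ht : t ≠ 0) (Λ lam K₁ r γ d : ℝ) :
    |t| ^ 3 * Λ * (lam * (K₁⁻¹ * r) / |t|) / (t ^ 2 * (γ / d ^ 2)) = lam * Λ * (K₁⁻¹ * r) * d ^ 2 / γ := by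
  have hta : |t| ≠ 0 := abs_ne_zero.mpr ht
  have ht2 : t ^ 2 = |t| ^ 2 := (sq_abs t).symm
  rw [ht2]
  field_simp

/-- **NEXT GRADIENT SIZE OVER THE NEXT RADIUS**: `(|t|·x_G K₁ ∕ (t²γ∕d²)) ∕ (λK₁⁻¹r∕|t|) = x_G K₁² d²∕(γ·λ·r)` — NO `t`
(`K₁ ≠ 0`). [folklore] -/
theorem nextGradientOverRadius_unit {t K₁ : ℝ} (ht : t ≠ 0) (hK : K₁ ≠ 0) (xG lam r γ d : ℝ) :
    |t| * (xG * K₁) / (t ^ 2 * (γ / d ^ 2)) / (lam * (K₁⁻¹ * r) / |t|) = xG * K₁ ^ 2 * d ^ 2 / (γ * lam * r) := by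
  have hta : |t| ≠ 0 := abs_ne_zero.mpr ht
  have ht2 : t ^ 2 = |t| ^ 2 := (sq_abs t).symm
  rw [ht2]
  field_simp

/-- **NEXT EQUIVALENCE CONDITION**: in coercivity units the inverse-coercivity summand is `1` at every scale, and the Hessian ratio
is `t`-free: `(1 + t²(x_B K₁²)∕(t²(γ∕d²)))·μ + 1 = (1 + x_B K₁² d²∕γ)·μ + 1`. [folklore] -/
theorem nextEquivCondition_unit {t : ℝ} (ht : t ≠ 0) (xB K₁ γ d μ : ℝ) :
    (1 + t ^ 2 * (xB * K₁ ^ 2) / (t ^ 2 * (γ / d ^ 2))) * μ + 1 = (1 + xB * K₁ ^ 2 * d ^ 2 / γ) * μ + 1 := by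
  rw [nextHessianSize_unit ht]

/-- **THE END — THE HOMOTHETY DROPS OUT.**  In coercivity units the four closing quantities of the step-plus-rescaling (HSTB's
`hN₂`-ratio, `hc₂r`-product at `r₂ = λK₁⁻¹r∕|t|`, the gradient-to-radius ratio, the equivalence condition) are the SAME real
numbers for every `t ≠ 0`: they depend on the chart constant `K₁`, the two-scale ratio `γ∕d²`, the radius fraction `λ` and the
scale-`k` normalised letters only. [folklore] -/
theorem closing_letters_t_free {t t' K₁ : ℝ} (ht : t ≠ 0) (ht' : t' ≠ 0) (hK : K₁ ≠ 0) (xB xG Λ lam r γ d μ : ℝ) :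
    t ^ 2 * (xB * K₁ ^ 2) / (t ^ 2 * (γ / d ^ 2)) = t' ^ 2 * (xB * K₁ ^ 2) / (t' ^ 2 * (γ / d ^ 2)) ∧
      |t| ^ 3 * Λ * (lam * (K₁⁻¹ * r) / |t|) / (t ^ 2 * (γ / d ^ 2)) =
        |t'| ^ 3 * Λ * (lam * (K₁⁻¹ * r) / |t'|) / (t' ^ 2 * (γ / d ^ 2)) ∧
      |t| * (xG * K₁) / (t ^ 2 * (γ / d ^ 2)) / (lam * (K₁⁻¹ * r) / |t|) =
        |t'| * (xG * K₁) / (t' ^ 2 * (γ / d ^ 2)) / (lam * (K₁⁻¹ * r) / |t'|) ∧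
      (1 + t ^ 2 * (xB * K₁ ^ 2) / (t ^ 2 * (γ / d ^ 2))) * μ + 1 =
        (1 + t' ^ 2 * (xB * K₁ ^ 2) / (t' ^ 2 * (γ / d ^ 2))) * μ + 1 := by
  refine ⟨?_, ?_, ?_, ?_⟩
  · rw [nextHessianSize_unit ht, nextHessianSize_unit ht']
  · rw [nextModulusNeed_unit ht, nextModulusNeed_unit ht']
  · rw [nextGradientOverRadius_unit ht hK, nextGradientOverRadius_unit ht' hK]
  · rw [nextEquivCondition_unit ht, nextEquivCondition_unit ht']

end TFree

/-! ## §4. Toys -/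

section Toys

/-- Toy: the action `V x = ‖x‖²`-type letter — scaling a bound `‖A‖ ≤ 6` by `m = 3` gives `‖m⁻¹•A‖ ≤ 2`. -/
example {G : Type*} [NormedAddCommGroup G] [NormedSpace ℝ G] {A : G} (h : ‖A‖ ≤ 6) : ‖(3 : ℝ)⁻¹ • A‖ ≤ 2 := by
  have h3 := unit_size (m := 3) (by norm_num) h
  rwa [show (6 : ℝ) / 3 = 2 by norm_num] at h3

/-- Toy: the next Hessian size with `t = 1∕8` and with `t = 1∕2` is the same number. -/
example (xB K₁ γ d : ℝ) :
    (1 / 8 : ℝ) ^ 2 * (xB * K₁ ^ 2) / ((1 / 8 : ℝ) ^ 2 * (γ / d ^ 2)) =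
      (1 / 2 : ℝ) ^ 2 * (xB * K₁ ^ 2) / ((1 / 2 : ℝ) ^ 2 * (γ / d ^ 2)) := by
  rw [nextHessianSize_unit (by norm_num : (1 / 8 : ℝ) ≠ 0), nextHessianSize_unit (by norm_num : (1 / 2 : ℝ) ≠ 0)]

end Toys

/-! ## §5 (v1.1, append-only). The dictionary back to `V ∘ σ` — the three letters HSUS ∕ HSUSC both need, ONCE (chair leaf-03 g150's
X-HSUSC RETURN-1: the same three lemmas under two namespaces would bounce the second filing `dedup.landed`; they live here and are
cited BY NAME from `…HardStepUnitStep` ∕ `…HardStepUnitStepCritical`) -/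

section Dictionary

variable {E F : Type*}

/-- `(θ • V) ∘ σ = θ • (V ∘ σ)` — definitionally. [folklore] -/
theorem smul_comp (V : E → ℝ) (σ : F → E) (θ : ℝ) : (θ • V) ∘ σ = θ • (V ∘ σ) := rfl

variable [NormedAddCommGroup F] [NormedSpace ℝ F]

/-- **CRITICALITY READS ON `V ∘ σ`** (`E` needs no structure: the derivative is taken on `F`): for `θ ≠ 0`, `D((θ • V) ∘ σ)(w) = 0 ↔ D(V ∘ σ)(w) = 0`. [folklore] -/
theorem fderiv_smul_comp_eq_zero_iff (V : E → ℝ) (σ : F → E) {θ : ℝ} (hθ : θ ≠ 0) (w : F) :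
    fderiv ℝ ((θ • V) ∘ σ) w = 0 ↔ fderiv ℝ (V ∘ σ) w = 0 := by
  rw [smul_comp, fderiv_const_smul_field, Pi.smul_apply, smul_eq_zero, or_iff_right hθ]

/-- **THE GRADIENT LETTER READS ON `V ∘ σ`**: `‖D((θ • V) ∘ σ)(w)‖ = |θ|·‖D(V ∘ σ)(w)‖`. [folklore] -/
theorem norm_fderiv_smul_comp (V : E → ℝ) (σ : F → E) (θ : ℝ) (w : F) :
    ‖fderiv ℝ ((θ • V) ∘ σ) w‖ = |θ| * ‖fderiv ℝ (V ∘ σ) w‖ := by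
  rw [smul_comp, norm_fderiv_smul]

/-- In coercivity units (`θ = m⁻¹`, `0 < m`): criticality of `(m⁻¹ • V) ∘ σ` at `w` is criticality of `V ∘ σ`, and the gradient
letter is divided by `m`. [folklore] -/
theorem unit_comp_letters (V : E → ℝ) (σ : F → E) {m : ℝ} (hm : 0 < m) (w : F) :
    (fderiv ℝ ((m⁻¹ • V) ∘ σ) w = 0 ↔ fderiv ℝ (V ∘ σ) w = 0) ∧
      ‖fderiv ℝ ((m⁻¹ • V) ∘ σ) w‖ = ‖fderiv ℝ (V ∘ σ) w‖ / m :=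
  ⟨fderiv_smul_comp_eq_zero_iff V σ (inv_ne_zero hm.ne') w, by
    rw [norm_fderiv_smul_comp, abs_of_pos (inv_pos.mpr hm), div_eq_inv_mul]⟩

end Dictionary

end Summit.QuantumFields.BalabanUV.T4Continuum.NE7b.ActionScalingLetters
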